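import Summits.BirchSwinnertonDyer.BirchSwinnertonDyer.Theorems.GenusKolyvaginAtTwoGenusDeepSupplyAtTwoNegDiscNarrowDepthZeroInertia
import Summits.BirchSwinnertonDyer.BirchSwinnertonDyer.Theorems.GenusKolyvaginAtTwoGenusDeepSupplyAtTwoNegDiscNarrowDepthZeroCriterion
import Summits.BirchSwinnertonDyer.BirchSwinnertonDyer.Theorems.GenusKolyvaginAtTwoKolyvaginRelationAtTwoLemma43
import Literature.NumberTheory.EllipticCurves.McCallum1991.KolyvaginLocalLeavesHolds
import Literature.NumberTheory.EllipticCurves.HeegnerPointsKolyvaginConjugation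
import Literature.NumberTheory.QuadraticFields.ConjugateIdealClass
import HarnessLib

/-!
# Route `GenusKolyvaginAtTwo`, crux 23491 `GenusDeepSupplyAtTwoNegDiscNarrow` (and 25504), registered stub C‴ at POSITIVE depth:
# THE REDUCTION CRITERION FOR DERIVED POINTS `P(n)`, INSTANTIATED — inertia lift to `K̄`, `E(K[n]) ↪ E(ℚ̄)` equivariance, Gross 5.4

Seat `bsd-line-gk2-p5` g33 (cell `bsd-f1-sign2`, WIDTH-5 attach), `--supports stmt-BirchSwinnertonDyer-23491 --as helper`.
THEOREMS ONLY (no definition, no named fact, no `sorry`).  **BSD is NOT proved by this file and no item is closed by it; the registered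
stubs C‴ / C⁺‴ / K₄ are untouched.**

WHAT.  The LEAD's positive-depth kernel (p762095, `GenusSupplyNarrow.geomReduction_eigen_of_two_smul_of_inertia` and its two sign-specialised
criteria `not_exists_two_smul_of_geomReduction_half_ne_zero` / `…_half_ne`) is stated for an abstract inertia element `γ ∈ I_𝔓 ≤ Γ_ℚ`, an abstract
`γ`-stable `2`-torsion-free `A ≤ E(ℚ̄)` and an abstract eigen-relation `γ • Y = ε • Y + 2 • R`.  This file instantiates it for Kolyvagin's DERIVED
POINTS `P(n) ∈ E(K[n])` (`KolyvaginHeegnerData.derivedPoint`) through the embedding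
`e_n := (RatClosure.pointsEquiv W)⁻¹ ∘ d.toGeomPoints : E(K[n]) → E(K̄) ≃ E(ℚ̄)`:
* §1 `exists_mem_inertia_isLiftOfAut` — at a prime `𝔓` of `\bar ℤ` over `ℓ ∣ d_K` some `γ ∈ I_𝔓(Γ_ℚ)` transports to a LIFT to `K̄` of the non-trivial
  `c ∈ Aut(K/ℚ)` (`IsLiftOfAut c (absGaloisTransport γ)`; sibling `DepthZero.exists_mem_inertia_not_mem_range_of_dvd_discr` + RatClosure);
* §2 `smul_pointsEquiv_symm_toGeomPoints` — `γ • e_n P = e_n (g • P)` for the automorphism `g` of `K[n]` that `γ` induces (`K[n]/ℚ` normal: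
  `RingClassConj.exists_algEquiv_apply_emb_eq`, `pointsMap_toGeomPoints_eq`, `RatClosure.pointsEquiv_smul_of_lift`);
* §3 `exists_inertia_eigen_derivedPoint` — **Gross's Prop. 5.4 READ AT THE INERTIA INVOLUTION**: for a square-free product `n` of Kolyvagin primes at
  `2` (Zhang-admissible, `kolyvaginIndex ≥ 1`) there are `γ ∈ I_𝔓(Γ_ℚ)` stabilising `e_n(E(K[n]))` and `R ∈ E(K[n])` with
  **`γ • e_n P(n) = ε_n • e_n P(n) + 2 • e_n R`**, `ε_n = −w(E)·(−1)^{#primes of n}` (tree: `McCallum1991.pointsMap_derivedPoint_concrete_of_prop53_zhang`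
  with Gross 5.3 DISCHARGED by `McCallum1991.exists_mem_ringClassGal_isOfFinAddOrder_conj_sub_smul` and Lemma 4.3 at `2` by
  `GenusExact.isAdmissible_pointsSubgroup_two`);
* §5 (APPEND) `exists_inertia_half_derivedPoint_criterion` — §3 + §4 assembled at the prime of the place over a good `ℓ ∣ d_K` (instrument I3);
* §4 the criteria in `E(K[n])`-currency: `not_exists_two_smul_derivedPoint_of_geomReduction_half_ne_zero` (sign `+1`: `red(e_n R) ≠ 0 ⟹ P(n) ∉ 2E(K[n])`)
  and `not_exists_two_smul_derivedPoint_of_geomReduction_half_ne` (sign `−1`: `red(e_n R) ≠ red(e_n P(n)) ⟹ P(n) ∉ 2E(K[n])`) — the conclusion shape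
  `¬ ∃ Q, 2 • Q = d.derivedPoint` of the supply cruxes' deep clause (memo `DEPTH-ZERO-REDUCTION-CRITERION-g21.md`, instrument I3).
Sign-free in `Δ_E`.  What this does NOT do: decide the reduction bits (beyond print).

References: [GrossLMS1991] §3 Prop. 3.6, §4 (4.1), Lemma 4.3, §5 Props. 5.3, 5.4; [McCallumLMS1991] §4 (4)–(5); [WZhang2014] Notations (xii);
[Serre1972] §1.11 Prop. 11; [NeukirchANT1999] Ch. I §9; [Cox2013] §9.A Lemma 9.3.
-/

set_option autoImplicit false
set_option linter.dupNamespace false -- `Summit.<P>.<Sub>` repeats `BirchSwinnertonDyer` (D-0017)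

noncomputable section

open scoped Classical NumberField Pointwise

namespace Summit.BirchSwinnertonDyer.BirchSwinnertonDyer.Theorems.GenusSupplyNarrow.DepthZero

open IsDedekindDomain Field NumberField WeierstrassCurve Literature.NumberTheory.EllipticCurves
  Literature.NumberTheory.EllipticCurves.ModularForms Literature.NumberTheory.GaloisRepresentations Rat.HeightOneSpectrum
  Summit.BirchSwinnertonDyer.BirchSwinnertonDyer.Theorems.GenusSupplyNarrow

variable {K : Type} [Field K] [NumberField K]

/-! ## §1 The inertia involution as a lift to `K̄` of the non-trivial automorphism of `K` -/

/-- **At a prime of `\bar ℤ` over a prime `ℓ ∣ d_K` some inertia element of `Γ_ℚ` transports to a lift of the non-trivial `c ∈ Aut(K/ℚ)`**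
(`K` quadratic): the element of §1 of `…DepthZeroInertia` outside `res(Γ_K)` restricts non-trivially to the normal extension `K/ℚ`
(`mem_range_absGaloisRestrict_iff`), `Aut(K/ℚ)` has two elements, and a transport is a lift of its restriction
(`RatClosure.isLiftOfAut_restrictNormal_absGaloisTransport`). [cite: NeukirchANT1999, Ch. I §9 Prop. (9.4)–(9.6)] [cite: GrossLMS1991, §3 (τ lifts)] -/
theorem exists_mem_inertia_isLiftOfAut (h2 : Module.finrank ℚ K = 2)
    {ℓ : ℕ} [Fact ℓ.Prime] (hℓ : (ℓ : ℤ) ∣ NumberField.discr K)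
    {v : HeightOneSpectrum (𝓞 ℚ)} (hv : (primesEquiv v : ℕ) = ℓ)
    {𝔓 : Ideal (absIntegers (𝓞 ℚ) ℚ)} (h𝔓 : 𝔓 ∈ v.primesAbove) {c : K ≃ₐ[ℚ] K} (hc : c ≠ 1) :
    ∃ γ ∈ 𝔓.inertia (absoluteGaloisGroup ℚ),
      IsLiftOfAut c (absGaloisTransport (K := ℚ) (L := K) γ).toRingEquiv := by
  haveI : Algebra.IsQuadraticExtension ℚ K := ⟨h2⟩
  haveI : IsGalois ℚ K := inferInstance
  have hcard : Nat.card (K ≃ₐ[ℚ] K) = 2 := by rw [IsGalois.card_aut_eq_finrank, h2]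
  obtain ⟨γ, hγI, hγ⟩ := exists_mem_inertia_not_mem_range_of_dvd_discr h2 hℓ hv h𝔓
  have hne : (absGaloisTransport (K := ℚ) (L := K) γ).restrictNormal K ≠ 1 := by
    intro h1
    apply hγ
    rw [mem_range_absGaloisRestrict_iff]
    intro x
    have h := AlgEquiv.restrictNormal_commutes (absGaloisTransport (K := ℚ) (L := K) γ) K x
    rw [h1, AlgEquiv.one_apply] at h
    exact h.symm
  rcases Literature.NumberTheory.QuadraticFields.eq_one_or_eq_of_card_eq_two hcard hc
      ((absGaloisTransport (K := ℚ) (L := K) γ).restrictNormal K) with h | h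
  · exact absurd h hne
  · exact ⟨γ, hγI, h ▸ RatClosure.isLiftOfAut_restrictNormal_absGaloisTransport γ⟩

/-! ## §2 `e_n = pointsEquiv⁻¹ ∘ toGeomPoints : E(K[n]) → E(ℚ̄)` is injective and `Γ_ℚ`-equivariant -/

section Embedding

variable (W : WeierstrassCurve ℚ) {N : ℕ} [NeZero N] {Dt : ModularParametrizationData W N} {β : ℤ} {ι : K →+* ℂ} {n : ℕ}

/-- `e_n = (RatClosure.pointsEquiv W)⁻¹ ∘ d.toGeomPoints : E(K[n]) → E(ℚ̄)` is injective. [folklore] -/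
theorem pointsEquiv_symm_toGeomPoints_injective (d : KolyvaginHeegnerData Dt β ι n) :
    Function.Injective fun P : (W.baseChange (ringClassField K ι n)).toAffine.Point ↦
      (RatClosure.pointsEquiv (K := K) W).symm (d.toGeomPoints P) := by
  intro P Q h
  have h' := (RatClosure.pointsEquiv (K := K) W).symm.injective h
  exact Affine.Point.map_injective (W' := W) d.emb.toRatAlgHom h'

/-- **Equivariance of `e_n`**: if the transport of `γ ∈ Γ_ℚ` to `K̄` is a lift of some `c ∈ Aut(K/ℚ)` and restricts along `d.emb` to
`g ∈ Aut_ℚ(K[n])`, then `γ • e_n P = e_n (g • P)` for every `P ∈ E(K[n])` (all actions are coordinatewise: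
`RatClosure.pointsEquiv_smul_of_lift`, `RingClassConj.pointsMap_toGeomPoints_eq`). [cite: Cox2013, §9.A Lemma 9.3] [cite: GrossLMS1991, §5] -/
theorem smul_pointsEquiv_symm_toGeomPoints (d : KolyvaginHeegnerData Dt β ι n) {γ : absoluteGaloisGroup ℚ} {c : K ≃ₐ[ℚ] K}
    (hτ : IsLiftOfAut c (absGaloisTransport (K := ℚ) (L := K) γ).toRingEquiv)
    {g : ringClassField K ι n ≃ₐ[ℚ] ringClassField K ι n}
    (hg : ∀ x, (absGaloisTransport (K := ℚ) (L := K) γ).toRingEquiv (d.emb x) = d.emb (g x))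
    (P : (W.baseChange (ringClassField K ι n)).toAffine.Point) :
    γ • (RatClosure.pointsEquiv (K := K) W).symm (d.toGeomPoints P) =
      (RatClosure.pointsEquiv (K := K) W).symm (d.toGeomPoints (pointGalHom W (ringClassField K ι n) g P)) := by
  apply (RatClosure.pointsEquiv (K := K) W).injective
  rw [RatClosure.pointsEquiv_smul_of_lift W hτ γ (fun _ ↦ rfl), AddEquiv.apply_symm_apply, AddEquiv.apply_symm_apply]
  exact McCallum1991.RingClassConj.pointsMap_toGeomPoints_eq d hτ hg P

/-- **`Γ_ℚ` stabilises `e_n(E(K[n]))`** (`K[n]/ℚ` is normal: every automorphism of `K̄` restricts along `d.emb` to one of `K[n]`,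
`RingClassConj.exists_algEquiv_apply_emb_eq`), for `γ` whose transport lifts some `c ∈ Aut(K/ℚ)`. [cite: Cox2013, §9.A Lemma 9.3] -/
theorem exists_smul_pointsEquiv_symm_toGeomPoints_eq (hK : IsImaginaryQuadratic K) (hn : n ≠ 0) (d : KolyvaginHeegnerData Dt β ι n)
    {γ : absoluteGaloisGroup ℚ} {c : K ≃ₐ[ℚ] K} (hτ : IsLiftOfAut c (absGaloisTransport (K := ℚ) (L := K) γ).toRingEquiv)
    (P : (W.baseChange (ringClassField K ι n)).toAffine.Point) :
    ∃ P' : (W.baseChange (ringClassField K ι n)).toAffine.Point,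
      γ • (RatClosure.pointsEquiv (K := K) W).symm (d.toGeomPoints P) = (RatClosure.pointsEquiv (K := K) W).symm (d.toGeomPoints P') := by
  obtain ⟨g, hg⟩ := McCallum1991.RingClassConj.exists_algEquiv_apply_emb_eq hK hn d
    (absGaloisTransport (K := ℚ) (L := K) γ).toRingEquiv
  exact ⟨_, smul_pointsEquiv_symm_toGeomPoints W d hτ hg P⟩

end Embedding

/-! ## §3 Gross's Prop. 5.4 at the inertia involution: the eigen-relation for `P(n)` in `E(ℚ̄)` -/

/-- **THE EIGEN-RELATION FOR THE DERIVED POINT AT AN INERTIA INVOLUTION.**  `W/ℚ` globally minimal of conductor `N`, `K` imaginary quadratic with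
the Heegner hypothesis, `d_K` odd and `≠ −3`, `ρ̄_{W,2}` onto and `d_K·Δ_W ∉ ℚ²` (Lemma 4.3 at `2`), `n` a square-free product of Kolyvagin primes at `2`
(Zhang-admissible with `kolyvaginIndex ≥ 1`, i.e. `2 ∣ a_q, q + 1`), `d` Kolyvagin–Heegner data at the levels `m ∣ n`, and `𝔓` a prime of `\bar ℤ`
over a prime `ℓ ∣ d_K`.  Then for some `γ ∈ I_𝔓(Γ_ℚ)` stabilising `e_n(E(K[n]))` and some `R ∈ E(K[n])`:
**`γ • e_n P(n) = ε_n • e_n P(n) + 2 • e_n R`, `ε_n = (−w(E))·(−1)^{#primes of n}`** — Gross's Prop. 5.4 (1) `τP(n) = ε_n P(n) + 2(…)` for the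
lift `τ = e γ e⁻¹` of complex conjugation (tree `McCallum1991.pointsMap_derivedPoint_concrete_of_prop53_zhang`; its inputs Prop. 5.3 and Lemma 4.3
at `2` are the tree theorems `exists_mem_ringClassGal_isOfFinAddOrder_conj_sub_smul`, `GenusExact.isAdmissible_pointsSubgroup_two`), transported to
`E(ℚ̄)` by §2.  [cite: GrossLMS1991, §5 Prop. 5.4 (1), Prop. 5.3, §3 Prop. 3.6, §4 Lemma 4.3] [cite: McCallumLMS1991, §4 (4)–(5)] [cite: WZhang2014, Notations (xii)] -/
theorem exists_inertia_eigen_derivedPoint (W : WeierstrassCurve ℚ) [W.IsElliptic] [W.IsGloballyMinimal] [NeZero (W.conductorNorm ℤ)]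
    (hK : IsImaginaryQuadratic K) (hH : SatisfiesHeegnerHypothesis (W.conductorNorm ℤ) K)
    (hodd : Odd (NumberField.discr K)) (h3 : NumberField.discr K ≠ -3)
    (hρ : W.HasSurjectiveModNGaloisRep 2) (hsq : ¬ IsSquare ((NumberField.discr K : ℚ) * W.Δ))
    (Dt : ModularParametrizationData W (W.conductorNorm ℤ)) {β : ℤ} (ι : K →+* ℂ)
    {n : ℕ} (hn : Squarefree n)
    (hkol : ∀ q ∈ n.primeFactors, Zhang2014.IsKolyvaginPrime (W.conductorNorm ℤ) W K 2 q ∧ 1 ≤ Zhang2014.kolyvaginIndex W 2 q)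
    (d : (m : ℕ) → m ∣ n → KolyvaginHeegnerData Dt β ι m)
    {ℓ : ℕ} [Fact ℓ.Prime] (hℓ : (ℓ : ℤ) ∣ NumberField.discr K)
    {v : HeightOneSpectrum (𝓞 ℚ)} (hv : (primesEquiv v : ℕ) = ℓ)
    {𝔓 : Ideal (absIntegers (𝓞 ℚ) ℚ)} (h𝔓 : 𝔓 ∈ v.primesAbove) :
    ∃ γ ∈ 𝔓.inertia (absoluteGaloisGroup ℚ),
      (∀ P : (W.baseChange (ringClassField K ι n)).toAffine.Point, ∃ P' : (W.baseChange (ringClassField K ι n)).toAffine.Point,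
        γ • (RatClosure.pointsEquiv (K := K) W).symm ((d n dvd_rfl).toGeomPoints P) =
          (RatClosure.pointsEquiv (K := K) W).symm ((d n dvd_rfl).toGeomPoints P')) ∧
      ∃ R : (W.baseChange (ringClassField K ι n)).toAffine.Point,
        γ • (RatClosure.pointsEquiv (K := K) W).symm ((d n dvd_rfl).toGeomPoints (d n dvd_rfl).derivedPoint) =
          (-W.rootNumber * (-1) ^ n.primeFactors.card) •
              (RatClosure.pointsEquiv (K := K) W).symm ((d n dvd_rfl).toGeomPoints (d n dvd_rfl).derivedPoint) +
            (2 : ℤ) • (RatClosure.pointsEquiv (K := K) W).symm ((d n dvd_rfl).toGeomPoints R) := by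
  have h2 : Module.finrank ℚ K = 2 := hK.1
  haveI : Algebra.IsQuadraticExtension ℚ K := ⟨h2⟩
  haveI : IsGalois ℚ K := inferInstance
  have hcard : Nat.card (K ≃ₐ[ℚ] K) = 2 := by rw [IsGalois.card_aut_eq_finrank, h2]
  -- a non-trivial automorphism of `K` and the inertia lift
  obtain ⟨c, hc1, -⟩ := (Nat.card_eq_two_iff' (1 : K ≃ₐ[ℚ] K)).mp hcard
  obtain ⟨γ, hγI, hτ⟩ := exists_mem_inertia_isLiftOfAut h2 hℓ hv h𝔓 (c := c) hc1
  have hn0 : n ≠ 0 := hn.ne_zero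
  refine ⟨γ, hγI, fun P ↦ exists_smul_pointsEquiv_symm_toGeomPoints_eq W hK hn0 (d n dvd_rfl) hτ P, ?_⟩
  -- Gross 5.4 (1) for the concrete derived point, with 5.3 and Lemma 4.3 at `2` discharged
  have hD4 : NumberField.discr K ≠ -4 := by
    rintro h4; rw [h4] at hodd; exact absurd hodd (by decide)
  have hD : NumberField.discr K < -4 := McCallum1991.KolyvaginAssembly.discr_lt_neg_four hK ⟨h3, hD4⟩
  have hND : IsCoprime ((W.conductorNorm ℤ : ℕ) : ℤ) (NumberField.discr K) :=
    McCallum1991.KolyvaginAssembly.isCoprime_discr_of_satisfiesHeegnerHypothesis hK hH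
  have h53 : ∀ (m : ℕ) (hm : m ∣ n) (τm : ringClassField K ι m ≃ₐ[ℚ] ringClassField K ι m),
      (∀ x : ringClassField K ι m, ((τm x : ringClassField K ι m) : ℂ) = starRingEnd ℂ x) →
      ∃ σ' ∈ ringClassGal ι m, IsOfFinAddOrder
        (pointGalHom W (ringClassField K ι m) τm (d m hm).y -
          (-W.rootNumber) • pointGalHom W (ringClassField K ι m) σ' (d m hm).y) := by
    intro m hm τm hτm
    obtain ⟨hm0, hmN⟩ := McCallum1991.ne_zero_and_coprime_of_isKolyvaginPrime (K := K) (p := 2)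
      (hn.squarefree_of_dvd hm) fun q hq ↦ (hkol q (Nat.primeFactors_mono hm hn0 hq)).1
    exact McCallum1991.exists_mem_ringClassGal_isOfFinAddOrder_conj_sub_smul W hK hH Dt ι hm0 hmN (d m hm) τm hτm
  have hA : ∀ (m : ℕ) (hm : m ∣ n),
      KolyvaginCocycle.IsAdmissible (absoluteGaloisGroup K) (d m hm).pointsSubgroup ((2 ^ 1 : ℕ) : ℤ) := by
    intro m hm
    obtain ⟨hm0, -⟩ := McCallum1991.ne_zero_and_coprime_of_isKolyvaginPrime (K := K) (p := 2)
      (hn.squarefree_of_dvd hm) fun q hq ↦ (hkol q (Nat.primeFactors_mono hm hn0 hq)).1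
    exact GenusExact.isAdmissible_pointsSubgroup_two (d m hm) hK hm0 hρ hsq 1
  obtain ⟨B, hB, h54⟩ := McCallum1991.pointsMap_derivedPoint_concrete_of_prop53_zhang hK ι Nat.prime_two le_rfl Dt hND hD
    hn hkol d hc1 hτ (-W.rootNumber) h53 hA n dvd_rfl
  obtain ⟨R, rfl⟩ := hB
  refine ⟨R, ?_⟩
  apply (RatClosure.pointsEquiv (K := K) W).injective
  rw [RatClosure.pointsEquiv_smul_of_lift W hτ γ (fun _ ↦ rfl), AddEquiv.apply_symm_apply, h54, map_add, map_zsmul, map_zsmul,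
    AddEquiv.apply_symm_apply, AddEquiv.apply_symm_apply, pow_one]
  rfl

/-! ## §4 The reduction criteria for `P(n)` in `E(K[n])`-currency -/

section Criteria

variable {ℓ : ℕ} [Fact ℓ.Prime] (W : WeierstrassCurve ℚ) [W.IsGloballyMinimal] [W.IsElliptic]
  (hΔ : ¬ (ℓ : ℤ) ∣ minimalDiscriminantInt W)
  {𝔓 : Ideal (absIntegers (𝓞 ℚ) ℚ)}
  (hmem : ∀ x : absIntegers (𝓞 ℚ) ℚ, x ∈ 𝔓 ↔ (x : AlgebraicClosure ℚ) ∈ (placeOver ℓ).nonunits)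
  {γ : absoluteGaloisGroup ℚ} (hγ : γ ∈ 𝔓.inertia (absoluteGaloisGroup ℚ))
  {N : ℕ} [NeZero N] {Dt : ModularParametrizationData W N} {β : ℤ} {ι : K →+* ℂ} {n : ℕ}

include hmem hγ in
/-- **SIGN `+1`: `red(e_n R) ≠ 0 ⟹ P(n) ∉ 2E(K[n])`.**  For an inertia element `γ ∈ I_𝔓` at the tree's place over a good prime `ℓ` stabilising
`e_n(E(K[n]))`, with `E(K[n])[2] = 0` (`ρ̄_{W,2}` onto, `d_K·Δ_W ∉ ℚ²`) and the eigen-relation `γ • e_n P(n) = e_n P(n) + 2 • e_n R` (§3 with `ε_n = +1`):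
if `R` does NOT reduce to `Õ`, the derived point `P(n)` has no square root in `E(K[n])` — the deep clause of the supply cruxes at level `n`.
(LEAD kernel `not_exists_two_smul_of_geomReduction_half_ne_zero` at `A = e_n(E(K[n]))`.) [cite: GrossLMS1991, §5 Prop. 5.4, §4 (4.1), Lemma 4.3]
[cite: Serre1972, §1.11, Prop. 11 (proof)] -/
theorem not_exists_two_smul_derivedPoint_of_geomReduction_half_ne_zero (hK : IsImaginaryQuadratic K) (hn : n ≠ 0)
    (hρ : W.HasSurjectiveModNGaloisRep 2) (hsq : ¬ IsSquare ((NumberField.discr K : ℚ) * W.Δ)) (d : KolyvaginHeegnerData Dt β ι n)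
    (hstab : ∀ P : (W.baseChange (ringClassField K ι n)).toAffine.Point, ∃ P' : (W.baseChange (ringClassField K ι n)).toAffine.Point,
      γ • (RatClosure.pointsEquiv (K := K) W).symm (d.toGeomPoints P) = (RatClosure.pointsEquiv (K := K) W).symm (d.toGeomPoints P'))
    {R : (W.baseChange (ringClassField K ι n)).toAffine.Point}
    (hrel : γ • (RatClosure.pointsEquiv (K := K) W).symm (d.toGeomPoints d.derivedPoint) =
      (1 : ℤ) • (RatClosure.pointsEquiv (K := K) W).symm (d.toGeomPoints d.derivedPoint) +
        (2 : ℤ) • (RatClosure.pointsEquiv (K := K) W).symm (d.toGeomPoints R))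
    (hred : geomReduction hΔ ((RatClosure.pointsEquiv (K := K) W).symm (d.toGeomPoints R)) ≠ 0) :
    ¬ ∃ Q : (W.baseChange (ringClassField K ι n)).toAffine.Point, (2 : ℤ) • Q = d.derivedPoint := by
  set e : (W.baseChange (ringClassField K ι n)).toAffine.Point →+ W.geomPoints :=
    (RatClosure.pointsEquiv (K := K) W).symm.toAddMonoidHom.comp d.toGeomPoints with he
  have heap : ∀ P, e P = (RatClosure.pointsEquiv (K := K) W).symm (d.toGeomPoints P) := fun _ ↦ rfl
  have heinj : Function.Injective e := pointsEquiv_symm_toGeomPoints_injective W d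
  have hA : ∀ P ∈ e.range, γ • P ∈ e.range := by
    rintro _ ⟨P, rfl⟩
    obtain ⟨P', hP'⟩ := hstab P
    exact ⟨P', by rw [heap, heap, hP']⟩
  have hA2 : ∀ P ∈ e.range, (2 : ℤ) • P = 0 → P = 0 := by
    rintro _ ⟨P, rfl⟩ h
    have h' : e ((2 : ℤ) • P) = e 0 := by rw [map_zsmul, h, map_zero]
    have hP2 : (2 : ℤ) • P = 0 := heinj h'
    have hbot := GenusExact.torsionBy_two_ringClassField_eq_bot W hK ι hn hρ hsq
    have hmemP : P ∈ AddSubgroup.torsionBy (W.baseChange (ringClassField K ι n)).toAffine.Point ((2 : ℕ) : ℤ) :=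
      (Submodule.mem_torsionBy_iff _ P).mpr (by exact_mod_cast hP2)
    rw [hbot] at hmemP
    rw [(AddSubgroup.mem_bot).mp hmemP, map_zero]
  have hkey := not_exists_two_smul_of_geomReduction_half_ne_zero (p := ℓ) hΔ hmem hγ e.range hA hA2 (Y := e d.derivedPoint)
    ⟨R, rfl⟩ hrel hred
  rintro ⟨Q, hQ⟩
  exact hkey ⟨e Q, ⟨Q, rfl⟩, by rw [← map_zsmul, hQ]⟩

include hmem hγ in
/-- **SIGN `−1`: `red(e_n R) ≠ red(e_n P(n)) ⟹ P(n) ∉ 2E(K[n])`** — the same with the eigen-relation `γ • e_n P(n) = −e_n P(n) + 2 • e_n R`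
(§3 with `ε_n = −1`; at `n = 1` this is the depth-zero criterion with `2R = τy_K + y_K`).  (LEAD kernel `not_exists_two_smul_of_geomReduction_half_ne`.)
[cite: GrossLMS1991, §5 Prop. 5.4, Prop. 5.3, §4 (4.1)] [cite: Serre1972, §1.11, Prop. 11 (proof)] -/
theorem not_exists_two_smul_derivedPoint_of_geomReduction_half_ne (hK : IsImaginaryQuadratic K) (hn : n ≠ 0)
    (hρ : W.HasSurjectiveModNGaloisRep 2) (hsq : ¬ IsSquare ((NumberField.discr K : ℚ) * W.Δ)) (d : KolyvaginHeegnerData Dt β ι n)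
    (hstab : ∀ P : (W.baseChange (ringClassField K ι n)).toAffine.Point, ∃ P' : (W.baseChange (ringClassField K ι n)).toAffine.Point,
      γ • (RatClosure.pointsEquiv (K := K) W).symm (d.toGeomPoints P) = (RatClosure.pointsEquiv (K := K) W).symm (d.toGeomPoints P'))
    {R : (W.baseChange (ringClassField K ι n)).toAffine.Point}
    (hrel : γ • (RatClosure.pointsEquiv (K := K) W).symm (d.toGeomPoints d.derivedPoint) =
      (-1 : ℤ) • (RatClosure.pointsEquiv (K := K) W).symm (d.toGeomPoints d.derivedPoint) +
        (2 : ℤ) • (RatClosure.pointsEquiv (K := K) W).symm (d.toGeomPoints R))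
    (hred : geomReduction hΔ ((RatClosure.pointsEquiv (K := K) W).symm (d.toGeomPoints R)) ≠
      geomReduction hΔ ((RatClosure.pointsEquiv (K := K) W).symm (d.toGeomPoints d.derivedPoint))) :
    ¬ ∃ Q : (W.baseChange (ringClassField K ι n)).toAffine.Point, (2 : ℤ) • Q = d.derivedPoint := by
  set e : (W.baseChange (ringClassField K ι n)).toAffine.Point →+ W.geomPoints :=
    (RatClosure.pointsEquiv (K := K) W).symm.toAddMonoidHom.comp d.toGeomPoints with he
  have heap : ∀ P, e P = (RatClosure.pointsEquiv (K := K) W).symm (d.toGeomPoints P) := fun _ ↦ rfl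
  have heinj : Function.Injective e := pointsEquiv_symm_toGeomPoints_injective W d
  have hA : ∀ P ∈ e.range, γ • P ∈ e.range := by
    rintro _ ⟨P, rfl⟩
    obtain ⟨P', hP'⟩ := hstab P
    exact ⟨P', by rw [heap, heap, hP']⟩
  have hA2 : ∀ P ∈ e.range, (2 : ℤ) • P = 0 → P = 0 := by
    rintro _ ⟨P, rfl⟩ h
    have h' : e ((2 : ℤ) • P) = e 0 := by rw [map_zsmul, h, map_zero]
    have hP2 : (2 : ℤ) • P = 0 := heinj h'
    have hbot := GenusExact.torsionBy_two_ringClassField_eq_bot W hK ι hn hρ hsq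
    have hmemP : P ∈ AddSubgroup.torsionBy (W.baseChange (ringClassField K ι n)).toAffine.Point ((2 : ℕ) : ℤ) :=
      (Submodule.mem_torsionBy_iff _ P).mpr (by exact_mod_cast hP2)
    rw [hbot] at hmemP
    rw [(AddSubgroup.mem_bot).mp hmemP, map_zero]
  have hkey := not_exists_two_smul_of_geomReduction_half_ne (p := ℓ) hΔ hmem hγ e.range hA hA2 (Y := e d.derivedPoint)
    ⟨R, rfl⟩ hrel hred
  rintro ⟨Q, hQ⟩
  exact hkey ⟨e Q, ⟨Q, rfl⟩, by rw [← map_zsmul, hQ]⟩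

end Criteria

/-! ## §5 (APPEND, same seat) The assembled test at a square-free level `n` over a good ramified prime `ℓ ∣ d_K` -/

/-- **THE POSITIVE-DEPTH REDUCTION TEST, ASSEMBLED** (instrument I3 of the memo `DEPTH-ZERO-REDUCTION-CRITERION-g21.md`).  In the frame of §3
(`W/ℚ` globally minimal, `K` Heegner with `d_K` odd `≠ −3`, `ρ̄_{W,2}` onto, `d_K·Δ_W ∉ ℚ²`, `n` a square-free product of Kolyvagin primes at `2`, data
`d` at the levels `m ∣ n`) and a GOOD prime `ℓ ∣ d_K`: there are an inertia element `γ ∈ Γ_ℚ` at the tree's place of `ℚ̄` over `ℓ` and a point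
`R ∈ E(K[n])` with the eigen-relation `γ • e_n P(n) = ε_n • e_n P(n) + 2 • e_n R` (`ε_n = −w(E)·(−1)^{#primes of n}`), and for THIS pair:
`ε_n = +1 ∧ red_ℓ(e_n R) ≠ Õ ⟹ P(n) ∉ 2E(K[n])`, `ε_n = −1 ∧ red_ℓ(e_n R) ≠ red_ℓ(e_n P(n)) ⟹ P(n) ∉ 2E(K[n])` — §3 at the prime of the place
(`exists_ideal_placeOver`) fed into the two criteria of §4.  [cite: GrossLMS1991, §5 Prop. 5.4, §4 (4.1), Lemma 4.3]
[cite: Serre1972, §1.11, Prop. 11 (proof)] [cite: McCallumLMS1991, §4 (4)–(5)] -/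
theorem exists_inertia_half_derivedPoint_criterion (W : WeierstrassCurve ℚ) [W.IsElliptic] [W.IsGloballyMinimal]
    [NeZero (W.conductorNorm ℤ)] (hK : IsImaginaryQuadratic K) (hH : SatisfiesHeegnerHypothesis (W.conductorNorm ℤ) K)
    (hodd : Odd (NumberField.discr K)) (h3 : NumberField.discr K ≠ -3)
    (hρ : W.HasSurjectiveModNGaloisRep 2) (hsq : ¬ IsSquare ((NumberField.discr K : ℚ) * W.Δ))
    (Dt : ModularParametrizationData W (W.conductorNorm ℤ)) {β : ℤ} (ι : K →+* ℂ)
    {n : ℕ} (hn : Squarefree n)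
    (hkol : ∀ q ∈ n.primeFactors, Zhang2014.IsKolyvaginPrime (W.conductorNorm ℤ) W K 2 q ∧ 1 ≤ Zhang2014.kolyvaginIndex W 2 q)
    (d : (m : ℕ) → m ∣ n → KolyvaginHeegnerData Dt β ι m)
    {ℓ : ℕ} [Fact ℓ.Prime] (hℓ : (ℓ : ℤ) ∣ NumberField.discr K) (hΔ : ¬ (ℓ : ℤ) ∣ minimalDiscriminantInt W) :
    ∃ (γ : absoluteGaloisGroup ℚ) (R : (W.baseChange (ringClassField K ι n)).toAffine.Point),
      γ • (RatClosure.pointsEquiv (K := K) W).symm ((d n dvd_rfl).toGeomPoints (d n dvd_rfl).derivedPoint) =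
          (-W.rootNumber * (-1) ^ n.primeFactors.card) •
              (RatClosure.pointsEquiv (K := K) W).symm ((d n dvd_rfl).toGeomPoints (d n dvd_rfl).derivedPoint) +
            (2 : ℤ) • (RatClosure.pointsEquiv (K := K) W).symm ((d n dvd_rfl).toGeomPoints R) ∧
      (-W.rootNumber * (-1) ^ n.primeFactors.card = 1 →
        geomReduction hΔ ((RatClosure.pointsEquiv (K := K) W).symm ((d n dvd_rfl).toGeomPoints R)) ≠ 0 →
        ¬ ∃ Q : (W.baseChange (ringClassField K ι n)).toAffine.Point, (2 : ℤ) • Q = (d n dvd_rfl).derivedPoint) ∧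
      (-W.rootNumber * (-1) ^ n.primeFactors.card = -1 →
        geomReduction hΔ ((RatClosure.pointsEquiv (K := K) W).symm ((d n dvd_rfl).toGeomPoints R)) ≠
          geomReduction hΔ ((RatClosure.pointsEquiv (K := K) W).symm ((d n dvd_rfl).toGeomPoints (d n dvd_rfl).derivedPoint)) →
        ¬ ∃ Q : (W.baseChange (ringClassField K ι n)).toAffine.Point, (2 : ℤ) • Q = (d n dvd_rfl).derivedPoint) := by
  -- the place `v = ℓ` and the prime of the place of `ℚ̄` over `ℓ`
  obtain ⟨v, hv⟩ : ∃ v : HeightOneSpectrum (𝓞 ℚ), (primesEquiv v : ℕ) = ℓ :=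
    ⟨primesEquiv.symm ⟨ℓ, Fact.out⟩, by rw [Equiv.apply_symm_apply]⟩
  obtain ⟨𝔓, hmem, h𝔓⟩ := exists_ideal_placeOver (p := ℓ) hv
  obtain ⟨γ, hγI, hstab, R, hrel⟩ := exists_inertia_eigen_derivedPoint W hK hH hodd h3 hρ hsq Dt ι hn hkol d hℓ hv h𝔓
  have hn0 : n ≠ 0 := hn.ne_zero
  refine ⟨γ, R, hrel, fun hε hred ↦ ?_, fun hε hred ↦ ?_⟩
  · rw [hε] at hrel
    exact not_exists_two_smul_derivedPoint_of_geomReduction_half_ne_zero W hΔ hmem hγI hK hn0 hρ hsq (d n dvd_rfl) hstab hrel hred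
  · rw [hε] at hrel
    exact not_exists_two_smul_derivedPoint_of_geomReduction_half_ne W hΔ hmem hγI hK hn0 hρ hsq (d n dvd_rfl) hstab hrel hred

end Summit.BirchSwinnertonDyer.BirchSwinnertonDyer.Theorems.GenusSupplyNarrow.DepthZero

end
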